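import Literature.NumberTheory.Transcendental.KZProductIdeal
import Literature.NumberTheory.Transcendental.KZLogCalculus
import Summits.KontsevichZagierPeriods.KontsevichZagierPeriods.Theorems.XMapPeriodTransfer.Negative.ValueSide

/-!
# Green's theorem on a lens INSIDE the Kontsevich–Zagier calculus (rule 3 twice + a swap)
(support of stmt-KontsevichZagierPeriods-14654 `JLPairIdentityOne`, route IsogenyCertificates;
reusable by any route)

The KZ-derivation of `JLPairIdentityOne` found in this session (work report §6, §8) transports the
complex-conjugate sheet of the explicit correspondence `Z_item` by CAUCHY's theorem on a
lens-shaped semialgebraic region `Ω₊ ⊂ ℂ ≅ ℝ²` bounded by the real axis and an algebraic arc `γ`.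
This file supplies the engine for that step as ONE theorem of the calculus, with no analytic
content left implicit.

`greenOnLens`: let `Ω = {(s,t) | s ∈ τ, a s ≤ t ≤ b s}` be a band over `τ ⊆ ℝ¹` (vertical
slices) which is ALSO a band `{(t,s) | t ∈ τ', c t ≤ s ≤ d t}` after swapping the coordinates
(horizontal slices; hypothesis `hlens`). Let `G` be `ℚ`-semialgebraic and integrable on `Ω`, `P` a
`ℚ`-semialgebraic fibrewise primitive of `G` along the vertical slices and `Q` one along the
horizontal slices (continuous on the closed slices, derivative `G` on the open slices — exactly the
regularity of rule (3)). Then for any representations `rT, rB` on `τ` with integrands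
`s ↦ P(s, b s)`, `s ↦ P(s, a s)` and `rR, rL` on `τ'` with integrands `t ↦ Q(t, d t)`,
`t ↦ Q(t, c t)`:
        `[rT] − [rB] − ([rR] − [rL]) ∈ KZ.relations`,
i.e. `∫_τ (P(s,b s) − P(s,a s)) ds = ∫_{τ'} (Q(t,d t) − Q(t,c t)) dt` as a chain of moves: rule (3)
along the last coordinate on `[Ω, G]`, rule (2) for the swap
(`KZ.of_sub_of_reindex_mem_relations`), rule (3) again on the swapped band, and rule (1b) to split
the two differences. For a closed `C¹` form `P ds + Q̃ dt` (`∂P/∂t = ∂Q̃/∂s = G`) this is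
Green/Cauchy, `∮_∂Ω (P ds + Q̃ dt) = 0`; the primitives entering rule (3) are the (semialgebraic)
coefficient functions, never the abelian integral.

References: M. Kontsevich, D. Zagier, *Periods* (2001), §1.2 rule (3) ("replace Newton–Leibniz by
Stokes").
-/

noncomputable section

open Set MeasureTheory
open Literature.NumberTheory.Transcendental Literature.ModelTheory.ExponentialFields
open Summit.KontsevichZagierPeriods.IsogenyCertificates.XMapPeriodTransferValue
  (of_add_of_neg_mem_relations)

namespace Summit.KontsevichZagierPeriods.IsogenyCertificates.GreenOnLens

/-- **Green's theorem on a lens as Kontsevich–Zagier moves.** See the module docstring: a band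
`Ω = band τ a b` over `τ ⊆ ℝ¹` whose coordinate swap is the band `band τ' c d`; `G` semialgebraic
and integrable on `Ω`; `P` (resp. `Q`, written in the swapped coordinates `(t,s)`) semialgebraic on
the band, continuous on each closed vertical (resp. horizontal) slice with derivative `G` on the
open slice; then the four edge representations satisfy `[rT] − [rB] − ([rR] − [rL]) ∈ KZ.relations`.
[cite: KontsevichZagier2001, §1.2 rule (3)] -/
theorem greenOnLens (τ τ' : Set (Fin 1 → ℝ)) (a b c d : (Fin 1 → ℝ) → ℝ)
    (ha : IsSemialgebraicFunOn ℚ τ a) (hb : IsSemialgebraicFunOn ℚ τ b) (hab : ∀ x ∈ τ, a x ≤ b x)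
    (hc : IsSemialgebraicFunOn ℚ τ' c) (hd : IsSemialgebraicFunOn ℚ τ' d)
    (hcd : ∀ y ∈ τ', c y ≤ d y)
    (hlens : {w : Fin 2 → ℝ | (fun i => w (Equiv.swap (0 : Fin 2) 1 i)) ∈ KZlog.band τ a b} =
      KZlog.band τ' c d)
    (G P Q : (Fin 2 → ℝ) → ℝ)
    (hG : IsSemialgebraicFunOn ℚ (KZlog.band τ a b) G) (hGi : IntegrableOn G (KZlog.band τ a b))
    (hP : IsSemialgebraicFunOn ℚ (KZlog.band τ a b) P)
    (hPc : ∀ x ∈ τ, ContinuousOn (fun t : ℝ => P (Fin.snoc x t)) (Icc (a x) (b x)))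
    (hPd : ∀ x ∈ τ, ∀ t ∈ Ioo (a x) (b x),
      HasDerivAt (fun s : ℝ => P (Fin.snoc x s)) (G (Fin.snoc x t)) t)
    (hQ : IsSemialgebraicFunOn ℚ (KZlog.band τ' c d) Q)
    (hQc : ∀ y ∈ τ', ContinuousOn (fun s : ℝ => Q (Fin.snoc y s)) (Icc (c y) (d y)))
    (hQd : ∀ y ∈ τ', ∀ s ∈ Ioo (c y) (d y),
      HasDerivAt (fun s' : ℝ => Q (Fin.snoc y s'))
        (G (fun i => (Fin.snoc y s : Fin 2 → ℝ) (Equiv.swap (0 : Fin 2) 1 i))) s)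
    (rT rB rR rL : KZ.IntegralRep 1)
    (hT : rT.domain = τ) (hB : rB.domain = τ) (hR : rR.domain = τ') (hL : rL.domain = τ')
    (hTi : ∀ x ∈ τ, rT.integrand x = P (Fin.snoc x (b x)))
    (hBi : ∀ x ∈ τ, rB.integrand x = P (Fin.snoc x (a x)))
    (hRi : ∀ y ∈ τ', rR.integrand y = Q (Fin.snoc y (d y)))
    (hLi : ∀ y ∈ τ', rL.integrand y = Q (Fin.snoc y (c y))) :
    KZ.of rT - KZ.of rB - (KZ.of rR - KZ.of rL) ∈ KZ.relations := by
  -- the two-dimensional representation `[Ω, G]` (vertical slicing)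
  have hτ : IsSemialgebraic ℚ τ := hT ▸ rT.isSemialgebraic_domain
  have hτ' : IsSemialgebraic ℚ τ' := hR ▸ rR.isSemialgebraic_domain
  let R : KZ.IntegralRep 2 := ⟨KZlog.band τ a b, G, KZlog.isSemialgebraic_band ha hb, hG, hGi⟩
  -- the vertical difference representation `[τ, P(·, b ·) − P(·, a ·)]`
  have hTsa : IsSemialgebraicFunOn ℚ τ rT.integrand := hT ▸ rT.isSemialgebraicFunOn_integrand
  have hBsa : IsSemialgebraicFunOn ℚ τ rB.integrand := hB ▸ rB.isSemialgebraicFunOn_integrand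
  have hTint : IntegrableOn rT.integrand τ := hT ▸ rT.integrableOn
  have hBint : IntegrableOn rB.integrand τ := hB ▸ rB.integrableOn
  let dv : KZ.IntegralRep 1 := ⟨τ, fun x => rT.integrand x - rB.integrand x, hτ,
    IsSemialgebraicFunOn.sub_holds hTsa hBsa, hTint.sub hBint⟩
  have hNLv : KZ.of R - KZ.of dv ∈ KZ.relations := by
    refine KZ.newtonLeibnizRel_subset_relations ⟨1, R, dv, a, b, P, hP, ha, hb, hab, rfl, hPc, hPd,
      ?_, rfl⟩
    intro x hx
    show rT.integrand x - rB.integrand x = P (Fin.snoc x (b x)) - P (Fin.snoc x (a x))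
    rw [hTi x hx, hBi x hx]
  have hAv : KZ.of dv - KZ.of rT - KZ.of rB.neg ∈ KZ.relations := by
    refine KZ.integrandAddRel_subset_relations ⟨1, dv, rT, rB.neg, hT, ?_, fun x _ => ?_, rfl⟩
    · rw [KZ.IntegralRep.domain_neg, hB]
    · show rT.integrand x - rB.integrand x = (rT.integrand + (rB.neg).integrand) x
      simp [KZ.IntegralRep.integrand_neg, sub_eq_add_neg]
  have hNb := of_add_of_neg_mem_relations rB
  -- the swap `(s,t) ↦ (t,s)` (rule 2) and the horizontal slicing
  have hS := KZ.of_sub_of_reindex_mem_relations R (Equiv.swap (0 : Fin 2) 1)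
  have hR'dom : (R.reindex (Equiv.swap (0 : Fin 2) 1)).domain = KZlog.band τ' c d := by
    rw [KZ.IntegralRep.reindex_domain]; exact hlens
  have hRsa : IsSemialgebraicFunOn ℚ τ' rR.integrand := hR ▸ rR.isSemialgebraicFunOn_integrand
  have hLsa : IsSemialgebraicFunOn ℚ τ' rL.integrand := hL ▸ rL.isSemialgebraicFunOn_integrand
  have hRint : IntegrableOn rR.integrand τ' := hR ▸ rR.integrableOn
  have hLint : IntegrableOn rL.integrand τ' := hL ▸ rL.integrableOn
  let dh : KZ.IntegralRep 1 := ⟨τ', fun y => rR.integrand y - rL.integrand y, hτ',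
    IsSemialgebraicFunOn.sub_holds hRsa hLsa, hRint.sub hLint⟩
  have hNLh : KZ.of (R.reindex (Equiv.swap (0 : Fin 2) 1)) - KZ.of dh ∈ KZ.relations := by
    refine KZ.newtonLeibnizRel_subset_relations
      ⟨1, R.reindex (Equiv.swap (0 : Fin 2) 1), dh, c, d, Q, ?_, hc, hd, hcd, ?_, hQc, ?_, ?_, rfl⟩
    · rw [hR'dom]; exact hQ
    · rw [hR'dom]; rfl
    · intro y hy s hs
      exact hQd y hy s hs
    · intro y hy
      show rR.integrand y - rL.integrand y = Q (Fin.snoc y (d y)) - Q (Fin.snoc y (c y))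
      rw [hRi y hy, hLi y hy]
  have hAh : KZ.of dh - KZ.of rR - KZ.of rL.neg ∈ KZ.relations := by
    refine KZ.integrandAddRel_subset_relations ⟨1, dh, rR, rL.neg, hR, ?_, fun y _ => ?_, rfl⟩
    · rw [KZ.IntegralRep.domain_neg, hL]
    · show rR.integrand y - rL.integrand y = (rR.integrand + (rL.neg).integrand) y
      simp [KZ.IntegralRep.integrand_neg, sub_eq_add_neg]
  have hNl := of_add_of_neg_mem_relations rL
  -- bookkeeping: target = hS + hNLh + hAh + hNl − hNLv − hAv − hNb
  have key := KZ.relations.sub_mem (KZ.relations.sub_mem (KZ.relations.sub_mem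
    (KZ.relations.add_mem (KZ.relations.add_mem (KZ.relations.add_mem hS hNLh) hAh) hNl) hNLv) hAv)
      hNb
  convert key using 1
  abel

end Summit.KontsevichZagierPeriods.IsogenyCertificates.GreenOnLens

end
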